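import Mathlib
import HarnessLib

/-!
# Route `KLProgramme`, crux K3 — engine-flow child (stmt-HubbardSuperconductivity-20437), stub (C) at `n = 0`, located brick «A-SIZES-WEIGHTED» (pen (R181)),
# brick 4a: ITERATED ABEL SUMMATION against a unimodular ratio, and iterated forward differences against derivatives

Cell gate-hubbard-kl, seat p1 g21.  The weighted row/column sizes of the scale-`0` grid covariance are obtained (bricks 4b–4d) from its entries written as
FINITE window sums `(1/β)Σ_{n<2M} qⁿ·H(ω₀ + n·2π/β)` (`q = e^{2πij/4M}` the grid phase ratio, `H` the torus momentum sum of the UV symbol at fixed frequency):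
`N′` summations by parts turn the phase ratio into the time decay `|q − 1|^{-N′} ~ (M/j)^{N′}`, paid for by `N′` forward differences of `H`, i.e. by
`∫‖H^{(N′)}‖`.  This file is the generic, model-free part:

* `abel_step` — `(q−1)·Σ_{n≤K} qⁿaₙ = q^{K+1}a_K − a₀ − q·Σ_{n<K} qⁿ(Δa)ₙ`;
* **`norm_abel_sum_le`** — for `‖q‖ = 1`, `q ≠ 1`, `N′ ≤ K`:
  `‖Σ_{n<K} qⁿaₙ‖ ≤ Σ_{i<N′} (‖Δⁱa_{K−1−i}‖ + ‖Δⁱa₀‖)/‖q−1‖^{i+1} + (Σ_{n<K−N′}‖Δ^{N′}aₙ‖)/‖q−1‖^{N′}`;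
* `fwdDiff_iter_samples` — differences of the samples `n ↦ f(x₀ + nh)` are the `h`-differences of `f`;
* `hasDerivAt_fwdDiff_iter`, `Continuous.fwdDiff_iter` — differences commute with the derivative;
* **`norm_fwdDiff_iter_le_integral`** — `‖Δ_h^{i} f(x)‖ ≤ h^{i−1}·∫_x^{x+ih}‖f^{(i)}‖` (`i ≥ 1`, `f ∈ Cⁱ`, `h ≥ 0`);
* `sum_integral_window_le` — `Σ_{n<K}∫_{x₀+nh}^{x₀+nh+ih} g ≤ i·∫_ℝ g` for `0 ≤ g ∈ L¹`.

Proofs only; no definitions; nothing here asserts (C), any stub of 20437, K3 or superconductivity.  References: BGM 2006 §2.2 (2.36aa) (summation by parts in the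
frequency) [cite: BenfattoGiulianiMastropietro2006]; Salmhofer 1999 §4.2.4 [cite: Salmhofer1999].
-/

noncomputable section

namespace Summit.HubbardSuperconductivity.HubbardSuperconductivity.Theorems.KLRegimeSplit

set_option linter.dupNamespace false -- summit = problem name (single-conjunct summit), D-0017

open Finset Complex Real MeasureTheory intervalIntegral Set
open scoped fwdDiff

/-! ## §1 Iterated Abel summation against a unimodular ratio -/

/-- **One summation by parts**: `(q − 1)·Σ_{n<K+1} qⁿ·aₙ = q^{K+1}·a_K − a₀ − q·Σ_{n<K} qⁿ·(a_{n+1} − aₙ)`. -/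
theorem abel_step (a : ℕ → ℂ) (q : ℂ) (K : ℕ) :
    (q - 1) * ∑ n ∈ range (K + 1), q ^ n * a n =
      q ^ (K + 1) * a K - a 0 - q * ∑ n ∈ range K, q ^ n * Δ_[1] a n := by
  induction K with
  | zero => rw [zero_add, sum_range_one, sum_range_zero]; ring
  | succ K ih =>
    rw [sum_range_succ, mul_add, ih, sum_range_succ]
    simp only [fwdDiff]
    ring

/-- **ITERATED ABEL SUMMATION**: for a unimodular ratio `q ≠ 1` and `N′ ≤ K`,
`‖Σ_{n<K} qⁿ·aₙ‖ ≤ Σ_{i<N′} (‖Δⁱa (K−(i+1))‖ + ‖Δⁱa 0‖)/‖q−1‖^{i+1} + (Σ_{n<K−N′} ‖Δ^{N′}a n‖)/‖q−1‖^{N′}`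
(`N′` edge terms at each end, and the `N′`-th differences in the bulk). -/
theorem norm_abel_sum_le {q : ℂ} (hq1 : ‖q‖ = 1) (hq : q ≠ 1) (N' : ℕ) :
    ∀ (a : ℕ → ℂ) (K : ℕ), N' ≤ K →
      ‖∑ n ∈ range K, q ^ n * a n‖ ≤
        ∑ i ∈ range N', (‖(Δ_[1])^[i] a (K - (i + 1))‖ + ‖(Δ_[1])^[i] a 0‖) / ‖q - 1‖ ^ (i + 1) +
          (∑ n ∈ range (K - N'), ‖(Δ_[1])^[N'] a n‖) / ‖q - 1‖ ^ N' := by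
  induction N' with
  | zero =>
    intro a K _
    simp only [range_zero, sum_empty, Nat.sub_zero, Function.iterate_zero, id_eq, pow_zero, div_one, zero_add]
    refine (norm_sum_le _ _).trans (le_of_eq (sum_congr rfl fun n _ => ?_))
    rw [norm_mul, norm_pow, hq1, one_pow, one_mul]
  | succ N' ih =>
    intro a K hK
    obtain ⟨K', rfl⟩ : ∃ K', K = K' + 1 := ⟨K - 1, by omega⟩
    have hq0 : 0 < ‖q - 1‖ := norm_pos_iff.2 (sub_ne_zero.2 hq)
    have hc : ‖q - 1‖ ≠ 0 := hq0.ne'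
    have heq : ∑ n ∈ range (K' + 1), q ^ n * a n =
        (q ^ (K' + 1) * a K' - a 0 - q * ∑ n ∈ range K', q ^ n * Δ_[1] a n) / (q - 1) := by
      rw [eq_div_iff (sub_ne_zero.2 hq), mul_comm, abel_step]
    have hIH := ih (Δ_[1] a) K' (by omega)
    rw [heq, norm_div, div_le_iff₀ hq0]
    calc ‖q ^ (K' + 1) * a K' - a 0 - q * ∑ n ∈ range K', q ^ n * Δ_[1] a n‖
        ≤ ‖a K'‖ + ‖a 0‖ + ‖∑ n ∈ range K', q ^ n * Δ_[1] a n‖ := by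
          refine (norm_sub_le _ _).trans (add_le_add ((norm_sub_le _ _).trans (le_of_eq ?_)) (le_of_eq ?_))
          · rw [norm_mul, norm_pow, hq1, one_pow, one_mul]
          · rw [norm_mul, hq1, one_mul]
      _ ≤ ‖a K'‖ + ‖a 0‖ + (∑ i ∈ range N', (‖(Δ_[1])^[i] (Δ_[1] a) (K' - (i + 1))‖ + ‖(Δ_[1])^[i] (Δ_[1] a) 0‖) / ‖q - 1‖ ^ (i + 1) +
          (∑ n ∈ range (K' - N'), ‖(Δ_[1])^[N'] (Δ_[1] a) n‖) / ‖q - 1‖ ^ N') := by gcongr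
      _ = (∑ i ∈ range (N' + 1), (‖(Δ_[1])^[i] a (K' + 1 - (i + 1))‖ + ‖(Δ_[1])^[i] a 0‖) / ‖q - 1‖ ^ (i + 1) +
          (∑ n ∈ range (K' + 1 - (N' + 1)), ‖(Δ_[1])^[N' + 1] a n‖) / ‖q - 1‖ ^ (N' + 1)) * ‖q - 1‖ := by
          rw [sum_range_succ', Nat.add_sub_add_right]
          simp only [Function.iterate_succ_apply, Function.iterate_zero, id_eq, Nat.add_sub_add_right, Nat.sub_zero,
            zero_add, pow_one]
          rw [add_mul, add_mul, sum_mul, div_mul_cancel₀ _ hc]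
          have h1 : ∀ i : ℕ, ∀ A : ℝ, A / ‖q - 1‖ ^ (i + 1 + 1) * ‖q - 1‖ = A / ‖q - 1‖ ^ (i + 1) := fun i A => by
            rw [pow_succ, div_mul_eq_mul_div, mul_div_mul_right _ _ hc]
          have h2 : ∀ A : ℝ, A / ‖q - 1‖ ^ (N' + 1) * ‖q - 1‖ = A / ‖q - 1‖ ^ N' := fun A => by
            rw [pow_succ, div_mul_eq_mul_div, mul_div_mul_right _ _ hc]
          simp only [h1, h2]
          ring

/-! ## §2 Forward differences of samples, and differences against derivatives -/

/-- **Differences of the samples are differences of the function**: `Δ¹ⁱ (n ↦ f(x₀ + n·h)) (n) = Δ_hⁱ f (x₀ + n·h)`. -/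
theorem fwdDiff_iter_samples {E : Type*} [AddCommGroup E] (f : ℝ → E) (x₀ h : ℝ) (i n : ℕ) :
    (Δ_[1])^[i] (fun m : ℕ => f (x₀ + m * h)) n = (Δ_[h])^[i] f (x₀ + n * h) := by
  rw [fwdDiff_iter_eq_sum_shift, fwdDiff_iter_eq_sum_shift]
  refine sum_congr rfl fun k _ => ?_
  congr 2
  simp only [smul_eq_mul, mul_one, Nat.cast_add, nsmul_eq_mul]
  ring

/-- Differences of a continuous function are continuous. -/
theorem continuous_fwdDiff {E : Type*} [NormedAddCommGroup E] {g : ℝ → E} (hg : Continuous g) (h : ℝ) :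
    Continuous (Δ_[h] g) :=
  (hg.comp (continuous_id.add continuous_const)).sub hg

/-- Iterated differences of a continuous function are continuous. -/
theorem continuous_fwdDiff_iter {E : Type*} [NormedAddCommGroup E] {g : ℝ → E} (h : ℝ) :
    ∀ (i : ℕ), Continuous g → Continuous ((Δ_[h])^[i] g)
  | 0, hg => hg
  | i + 1, hg => by
    rw [Function.iterate_succ_apply]
    exact continuous_fwdDiff_iter h i (continuous_fwdDiff hg h)

/-- **Differences commute with the derivative**: if `f′` is a derivative of `f` everywhere, then `Δ_hⁱ f′(x)` is a derivative of `Δ_hⁱ f` at `x`. -/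
theorem hasDerivAt_fwdDiff_iter {f f' : ℝ → ℂ} (hf : ∀ x, HasDerivAt f (f' x) x) (h : ℝ) (i : ℕ) (x : ℝ) :
    HasDerivAt ((Δ_[h])^[i] f) ((Δ_[h])^[i] f' x) x := by
  have h1 : (Δ_[h])^[i] f = fun y => ∑ k ∈ range (i + 1), ((((-1 : ℤ) ^ (i - k) * i.choose k : ℤ) : ℂ)) * f (y + k • h) := by
    funext y
    rw [fwdDiff_iter_eq_sum_shift]
    exact sum_congr rfl fun k _ => by rw [zsmul_eq_mul]
  rw [h1, fwdDiff_iter_eq_sum_shift]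
  simp_rw [zsmul_eq_mul]
  refine HasDerivAt.fun_sum fun k _ => ?_
  exact ((hf (x + k • h)).comp_add_const x (k • h)).const_mul _

/-- **ITERATED DIFFERENCES AGAINST THE DERIVATIVE, integral form**: for `h ≥ 0`, `i ≥ 1` and `f ∈ Cⁱ(ℝ)`,
`‖Δ_hⁱ f(x)‖ ≤ h^{i−1}·∫_x^{x+ih} ‖f^{(i)}(t)‖ dt` (peel the outermost difference as `∫_x^{x+h}(Δ_h^{i−1}f′)`; the inner window
`[t, t+(i−1)h] ⊆ [x, x+ih]`). -/
theorem norm_fwdDiff_iter_le_integral {h : ℝ} (hh : 0 ≤ h) (i : ℕ) (hi : 1 ≤ i) :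
    ∀ (f : ℝ → ℂ), ContDiff ℝ i f → ∀ x : ℝ,
      ‖(Δ_[h])^[i] f x‖ ≤ h ^ (i - 1) * ∫ t in x..(x + i * h), ‖iteratedDeriv i f t‖ := by
  induction i, hi using Nat.le_induction with
  | base =>
    intro f hf x
    simp only [Function.iterate_one, Nat.sub_self, pow_zero, one_mul, Nat.cast_one, iteratedDeriv_one]
    have hd : Differentiable ℝ f := hf.differentiable (by simp)
    have hcont : Continuous (deriv f) := hf.continuous_deriv (by simp)
    have hftc := integral_eq_sub_of_hasDerivAt (a := x) (b := x + h) (fun t _ => (hd t).hasDerivAt) (hcont.intervalIntegrable _ _)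
    rw [fwdDiff, ← hftc]
    exact norm_integral_le_integral_norm (by linarith)
  | succ i hi ih =>
    intro f hf x
    have hf1 := (contDiff_succ_iff_deriv (n := ((i : ℕ) : WithTop ℕ∞)) (f := f)).1 (by exact_mod_cast hf)
    have hd : Differentiable ℝ f := hf1.1
    have hf' : ContDiff ℝ i (deriv f) := hf1.2.2
    have hderiv : ∀ t, HasDerivAt ((Δ_[h])^[i] f) ((Δ_[h])^[i] (deriv f) t) t :=
      hasDerivAt_fwdDiff_iter (fun t => (hd t).hasDerivAt) h i
    have hcont : Continuous ((Δ_[h])^[i] (deriv f)) := continuous_fwdDiff_iter h i hf'.continuous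
    have hcontN : Continuous fun s => ‖iteratedDeriv (i + 1) f s‖ := (hf.continuous_iteratedDeriv (i + 1) le_rfl).norm
    have hftc := integral_eq_sub_of_hasDerivAt (a := x) (b := x + h) (fun t _ => hderiv t) (hcont.intervalIntegrable _ _)
    rw [Function.iterate_succ_apply', fwdDiff, ← hftc]
    have hxh : x ≤ x + h := by linarith
    calc ‖∫ t in x..x + h, (Δ_[h])^[i] (deriv f) t‖
        ≤ ∫ t in x..x + h, ‖(Δ_[h])^[i] (deriv f) t‖ := norm_integral_le_integral_norm hxh
      _ ≤ ∫ t in x..x + h, h ^ (i - 1) * ∫ s in x..(x + ((i + 1 : ℕ) : ℝ) * h), ‖iteratedDeriv (i + 1) f s‖ := by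
          refine intervalIntegral.integral_mono_on hxh (hcont.norm.intervalIntegrable _ _) (by simp) fun t ht => ?_
          refine (ih (deriv f) hf' t).trans ?_
          rw [← iteratedDeriv_succ']
          refine mul_le_mul_of_nonneg_left ?_ (by positivity)
          have hih : (0 : ℝ) ≤ (i : ℝ) * h := by positivity
          refine intervalIntegral.integral_mono_interval ht.1 (by linarith) ?_ (ae_of_all _ fun _ => norm_nonneg _)
            (hcontN.intervalIntegrable _ _)
          push_cast
          nlinarith [ht.2]
      _ = h * (h ^ (i - 1) * ∫ s in x..(x + ((i + 1 : ℕ) : ℝ) * h), ‖iteratedDeriv (i + 1) f s‖) := by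
          rw [intervalIntegral.integral_const, smul_eq_mul, add_sub_cancel_left]
      _ = h ^ (i + 1 - 1) * ∫ s in x..(x + ((i + 1 : ℕ) : ℝ) * h), ‖iteratedDeriv (i + 1) f s‖ := by
          rw [← mul_assoc, ← pow_succ', Nat.sub_add_cancel hi, Nat.add_sub_cancel]

/-- **Edge form**: with a pointwise bound `‖f^{(i)}‖ ≤ B` on `[x, x + ih]`, `‖Δ_hⁱ f(x)‖ ≤ i·hⁱ·B` (`i ≥ 1`). -/
theorem norm_fwdDiff_iter_le_pow_mul {h : ℝ} (hh : 0 ≤ h) {i : ℕ} (hi : 1 ≤ i) {f : ℝ → ℂ} (hf : ContDiff ℝ i f) (x : ℝ) {B : ℝ}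
    (hB : ∀ t ∈ Icc x (x + i * h), ‖iteratedDeriv i f t‖ ≤ B) : ‖(Δ_[h])^[i] f x‖ ≤ i * h ^ i * B := by
  have h1 := norm_fwdDiff_iter_le_integral hh i hi f hf x
  have hih : x ≤ x + i * h := by
    have : (0 : ℝ) ≤ (i : ℝ) * h := by positivity
    linarith
  have h2 : ∫ t in x..(x + i * h), ‖iteratedDeriv i f t‖ ≤ ∫ t in x..(x + i * h), B := by
    refine intervalIntegral.integral_mono_on hih ((hf.continuous_iteratedDeriv i le_rfl).norm.intervalIntegrable _ _) (by simp) hB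
  rw [intervalIntegral.integral_const, smul_eq_mul, add_sub_cancel_left] at h2
  calc ‖(Δ_[h])^[i] f x‖ ≤ h ^ (i - 1) * ∫ t in x..(x + i * h), ‖iteratedDeriv i f t‖ := h1
    _ ≤ h ^ (i - 1) * (i * h * B) := mul_le_mul_of_nonneg_left h2 (by positivity)
    _ = i * h ^ i * B := by
        rw [show h ^ i = h ^ (i - 1) * h by rw [← pow_succ, Nat.sub_add_cancel hi]]; ring

/-! ## §3 Summing window integrals -/

/-- Adjacent windows: `Σ_{l<m} ∫_{c+lh}^{c+(l+1)h} g = ∫_c^{c+mh} g` (`g ∈ L¹`). -/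
theorem sum_integral_adjacent_windows {g : ℝ → ℝ} (hg : Integrable g) (c h : ℝ) (m : ℕ) :
    ∑ l ∈ range m, ∫ t in (c + l * h)..(c + (l + 1) * h), g t = ∫ t in c..(c + m * h), g t := by
  have key := sum_integral_adjacent_intervals (μ := volume) (f := g) (a := fun l : ℕ => c + (l : ℝ) * h) (n := m)
    (fun k _ => hg.intervalIntegrable)
  simp only [Nat.cast_zero, zero_mul, add_zero, Nat.cast_succ] at key
  exact key

/-- **Window integrals overlap at most `i` times**: for `0 ≤ g ∈ L¹(ℝ)`,
`Σ_{n<K} ∫_{x₀+nh}^{x₀+nh+ih} g ≤ i·∫_ℝ g`. -/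
theorem sum_integral_window_le {g : ℝ → ℝ} (hg : Integrable g) (hg0 : ∀ t, 0 ≤ g t) (x₀ h : ℝ) (hh : 0 ≤ h) (i K : ℕ) :
    ∑ n ∈ range K, ∫ t in (x₀ + n * h)..(x₀ + n * h + i * h), g t ≤ i * ∫ t, g t := by
  have hwin : ∀ n : ℕ, ∫ t in (x₀ + n * h)..(x₀ + n * h + i * h), g t =
      ∑ l ∈ range i, ∫ t in (x₀ + l * h + n * h)..(x₀ + l * h + (n + 1) * h), g t := by
    intro n
    rw [← sum_integral_adjacent_windows hg (x₀ + n * h) h i]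
    exact sum_congr rfl fun l _ => by congr 1 <;> ring
  rw [sum_congr rfl fun n _ => hwin n, sum_comm]
  calc ∑ l ∈ range i, ∑ n ∈ range K, ∫ t in (x₀ + l * h + n * h)..(x₀ + l * h + (n + 1) * h), g t
      = ∑ l ∈ range i, ∫ t in (x₀ + l * h)..(x₀ + l * h + K * h), g t :=
        sum_congr rfl fun l _ => sum_integral_adjacent_windows hg (x₀ + l * h) h K
    _ ≤ ∑ l ∈ range i, ∫ t, g t := by
        refine sum_le_sum fun l _ => ?_
        have hle : x₀ + l * h ≤ x₀ + l * h + K * h := by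
          have : (0 : ℝ) ≤ (K : ℝ) * h := by positivity
          linarith
        rw [intervalIntegral.integral_of_le hle]
        exact setIntegral_le_integral hg (ae_of_all _ hg0)
    _ = i * ∫ t, g t := by rw [sum_const, card_range, nsmul_eq_mul]

end Summit.HubbardSuperconductivity.HubbardSuperconductivity.Theorems.KLRegimeSplit

end
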